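import Summits.MatrixMultiplication.OmegaCensus.STPPVosperSlackTwoRows59L1TblA1

/-!
# ω-census (abelian STPP census): ℤ₅₉ leaf L1 = {(2,2,2),(3,3,3)²} — dead-table rows for case A (= B′) — table rows assembled

HONEST FRAMING (pub-omega census; verbatim): lottery ticket; floor = certified bounds/negative ranges.
Census STRUCTURE (seat pub-omega-stpp-2 gen 27, 2026-08-29), family (b2).  `dead59L1A : ∀ e ∈ tblZ59L1A, … = false` glued from 1 chunk theorems.  No new computation.
Nothing here is progress on `ω`.
-/

namespace Summit.MatrixMultiplication.OmegaCensus.CubeNB.S2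

open Summit.MatrixMultiplication.OmegaCensus.CubeNB

/-- **Dead table `tblZ59L1A`**: every entry's words-cover search fails. [folklore] -/
theorem dead59L1A : ∀ e ∈ tblZ59L1A, existsCoverW 59 e.1 e.2 [blockDiffsWQ 59 e.1 e.2 3 3 3, blockDiffsWQ 59 e.1 e.2 2 2 2] [] [] [] = false := by
  have h2 : ∀ e ∈ tblZ59L1A.drop 2, existsCoverW 59 e.1 e.2 [blockDiffsWQ 59 e.1 e.2 3 3 3, blockDiffsWQ 59 e.1 e.2 2 2 2] [] [] [] = false := by
    intro e he
    rw [show tblZ59L1A.drop 2 = [] from by decide] at he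
    exact absurd he List.not_mem_nil
  have h0 : ∀ e ∈ tblZ59L1A.drop 0, existsCoverW 59 e.1 e.2 [blockDiffsWQ 59 e.1 e.2 3 3 3, blockDiffsWQ 59 e.1 e.2 2 2 2] [] [] [] = false :=
    forall_drop_of_take_drop _ 0 2 dead59L1A_c0 (by rw [show 0 + 2 = 2 from rfl]; exact h2)
  intro e he
  exact h0 e (by rwa [List.drop_zero])

end Summit.MatrixMultiplication.OmegaCensus.CubeNB.S2
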